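import Mathlib
import Summits.NavierStokesRegularity.NavierStokesRegularity.Theorems.FilamentSkeletonRssKelvinGatePressurePoisson
import Literature.Analysis.FluidPDE.DecayingScalarIntegrationByParts

/-!
# Route `FilamentSkeletonRss` · crux `TransverseReductionRJ` (stmt-NavierStokesRegularity-21221) — line `kelvin_gate`,
# stub S2′ `EventualKelvinGate`: THE FREE PRESSURE `Q = Σⱼ ∂ⱼΓ ⋆ Fⱼ` OF A `Y`-FIELD (package)

Helper file (theorems only, `--supports stmt-NavierStokesRegularity-21221 --as helper`).  HONEST FRAMING: analysis
bookkeeping for a HYPOTHETICAL filament-type rotating-self-similar blow-up route; nothing here bears on Navier–Stokes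
regularity; no stub is proved here.

For a vector datum `F : ℝ³ → ℝ³` of the gate's `Y`-scale (`(1+|y|)²‖F‖ ≤ R₀`, and for the `C¹` statements
`(1+|y|)²‖DF‖ ≤ R₁`) the free pressure is `Q(x) = Σⱼ T_{eⱼ}(Fⱼ)(x) = Σⱼ ∫ ∂ⱼΓ(x − y) Fⱼ(y) dy` (`newtonGradPotential` of
the coordinates; written out, no definition).  Assembled from `…PressureDecay`, `…PressureGradient`, `…PressurePoisson`:

* `abs_freePressure_le` — **`|Q(x)| ≤ 3 (R₀/4π) 12V/(1+|x|)`** (`V = 3|B₁| = 4π`): bounded, as GateSpec asks, and `O(1/|x|)`;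
* `contDiff_one_freePressure`, `norm_fderiv_freePressure_le` — **`Q ∈ C¹`, `‖∇Q(x)‖ ≤ 3 (R₁/4π) 12V/(1+|x|)`**;
* `integral_freePressure_mul_laplacian` — **`∫ Q Δφ = ∫ φ div F`** for `φ ∈ C³_c`: `ΔQ = div F` in `𝒟′(ℝ³)`, i.e. the
  projected datum `F − ∇Q` is weakly divergence-free.

This is the pressure clause of the free Kelvin gate at `U⁰ = 0` (evidence #28, route R1 step (P1)); what it does NOT
give is `W = R(F − ∇Q) ∈ X`: `F − ∇Q` is only `C⁰` with a `⟨y⟩⁻¹` bound, below the data class of `free_resolvent`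
(`…KelvinGateFreeResolvent`), and the honest decay `∇Q = O(⟨y⟩⁻² log⟨y⟩)` is Calderón–Zygmund-level, not kernel-size level.
-/

set_option linter.dupNamespace false

noncomputable section

namespace Summit.NavierStokesRegularity.NavierStokesRegularity.Theorems.KelvinGate

open Set Function Filter MeasureTheory Metric Real
open Literature.Analysis.FluidPDE Literature.Analysis.FluidPDE.NewtonPotentialHolder
open scoped ENNReal Topology Laplacian RealInnerProductSpace BigOperators

section FreePressure

variable {F : EuclideanSpace ℝ (Fin 3) → EuclideanSpace ℝ (Fin 3)} {R₀ R₁ : ℝ}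

/-! ## Coordinates of a `Y`-field -/

/-- The coordinates inherit the weight bound: `(1+|y|)² |Fⱼ(y)| ≤ R₀`. -/
theorem sq_weight_abs_coord_le (h0 : ∀ y, (1 + ‖y‖) ^ 2 * ‖F y‖ ≤ R₀) (j : Fin 3) (y : EuclideanSpace ℝ (Fin 3)) :
    (1 + ‖y‖) ^ 2 * |F y j| ≤ R₀ := by
  have h : |F y j| ≤ ‖F y‖ := by simpa using PiLp.norm_apply_le (F y) j
  exact le_trans (mul_le_mul_of_nonneg_left h (by positivity)) (h0 y)

/-- The coordinates of a `C¹` field are `C¹`. -/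
theorem contDiff_coord (hF : ContDiff ℝ 1 F) (j : Fin 3) : ContDiff ℝ 1 (fun y => F y j) :=
  (EuclideanSpace.proj (𝕜 := ℝ) j).contDiff.comp hF

/-- `D(Fⱼ)(y) = eⱼ* ∘ DF(y)`. -/
theorem fderiv_coord (hF : ContDiff ℝ 1 F) (j : Fin 3) (y : EuclideanSpace ℝ (Fin 3)) :
    fderiv ℝ (fun y => F y j) y = (EuclideanSpace.proj j).comp (fderiv ℝ F y) :=
  ((EuclideanSpace.proj (𝕜 := ℝ) j).hasFDerivAt.comp y ((hF.differentiable one_ne_zero) y).hasFDerivAt).fderiv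

/-- The coordinate derivatives inherit the weight bound: `(1+|y|)² ‖DFⱼ(y)‖ ≤ R₁`. -/
theorem sq_weight_norm_fderiv_coord_le (hF : ContDiff ℝ 1 F) (h1 : ∀ y, (1 + ‖y‖) ^ 2 * ‖fderiv ℝ F y‖ ≤ R₁)
    (j : Fin 3) (y : EuclideanSpace ℝ (Fin 3)) :
    (1 + ‖y‖) ^ 2 * ‖fderiv ℝ (fun y => F y j) y‖ ≤ R₁ := by
  rw [fderiv_coord hF j y]
  have hp : ‖(EuclideanSpace.proj (𝕜 := ℝ) j : EuclideanSpace ℝ (Fin 3) →L[ℝ] ℝ)‖ ≤ 1 := by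
    refine ContinuousLinearMap.opNorm_le_bound _ zero_le_one fun v => ?_
    rw [one_mul]
    simpa using PiLp.norm_apply_le v j
  have h : ‖(EuclideanSpace.proj (𝕜 := ℝ) j).comp (fderiv ℝ F y)‖ ≤ ‖fderiv ℝ F y‖ :=
    (ContinuousLinearMap.opNorm_comp_le _ _).trans (by nlinarith [norm_nonneg (fderiv ℝ F y)])
  exact le_trans (mul_le_mul_of_nonneg_left h (by positivity)) (h1 y)

/-! ## Size, regularity and decay of the free pressure -/

/-- **The free pressure is bounded and decays**: `|Σⱼ T_{eⱼ}Fⱼ(x)| ≤ 3 · (R₀/4π) · 12V/(1+|x|)`. -/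
theorem abs_freePressure_le (h0 : ∀ y, (1 + ‖y‖) ^ 2 * ‖F y‖ ≤ R₀) (x : EuclideanSpace ℝ (Fin 3)) :
    |∑ j : Fin 3, newtonGradPotential (EuclideanSpace.single j (1:ℝ)) (fun y => F y j) x| ≤
      3 * (R₀ / (4 * π) * (12 * (3 * (volume : Measure (EuclideanSpace ℝ (Fin 3))).real (ball 0 1)) / (1 + ‖x‖))) := by
  have hj : ∀ j : Fin 3, |newtonGradPotential (EuclideanSpace.single j (1:ℝ)) (fun y => F y j) x| ≤
      R₀ / (4 * π) * (12 * (3 * (volume : Measure (EuclideanSpace ℝ (Fin 3))).real (ball 0 1)) / (1 + ‖x‖)) := by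
    intro j
    have h := abs_newtonGradPotential_le_of_sq_weight (sq_weight_abs_coord_le h0 j) (EuclideanSpace.single j (1:ℝ)) x
    have e : ‖EuclideanSpace.single j (1:ℝ)‖ = 1 := by simp
    rw [e, one_mul] at h
    exact h
  calc |∑ j : Fin 3, newtonGradPotential (EuclideanSpace.single j (1:ℝ)) (fun y => F y j) x|
      ≤ ∑ j : Fin 3, |newtonGradPotential (EuclideanSpace.single j (1:ℝ)) (fun y => F y j) x| :=
        Finset.abs_sum_le_sum_abs _ _
    _ ≤ ∑ _j : Fin 3, R₀ / (4 * π) * (12 * (3 * (volume : Measure (EuclideanSpace ℝ (Fin 3))).real (ball 0 1)) /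
          (1 + ‖x‖)) := Finset.sum_le_sum fun j _ => hj j
    _ = _ := by rw [Finset.sum_const, Finset.card_univ, Fintype.card_fin]; simp

/-- **The free pressure is `C¹`** for a `C¹` datum with `(1+|y|)²‖F‖ ≤ R₀`, `(1+|y|)²‖DF‖ ≤ R₁`. -/
theorem contDiff_one_freePressure (hF : ContDiff ℝ 1 F) (h0 : ∀ y, (1 + ‖y‖) ^ 2 * ‖F y‖ ≤ R₀)
    (h1 : ∀ y, (1 + ‖y‖) ^ 2 * ‖fderiv ℝ F y‖ ≤ R₁) :
    ContDiff ℝ 1 (fun x => ∑ j : Fin 3, newtonGradPotential (EuclideanSpace.single j (1:ℝ)) (fun y => F y j) x) :=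
  ContDiff.sum fun j _ => contDiff_one_newtonGradPotential_of_sq_weight (contDiff_coord hF j)
    (fun y => by rw [Real.norm_eq_abs]; exact sq_weight_abs_coord_le h0 j y) (sq_weight_norm_fderiv_coord_le hF h1 j) _

/-- **Decay of the free pressure gradient**: `‖∇Q(x)‖ ≤ 3 · (R₁/4π) · 12V/(1+|x|)`. -/
theorem norm_fderiv_freePressure_le (hF : ContDiff ℝ 1 F) (h0 : ∀ y, (1 + ‖y‖) ^ 2 * ‖F y‖ ≤ R₀)
    (h1 : ∀ y, (1 + ‖y‖) ^ 2 * ‖fderiv ℝ F y‖ ≤ R₁) (x : EuclideanSpace ℝ (Fin 3)) :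
    ‖fderiv ℝ (fun x => ∑ j : Fin 3, newtonGradPotential (EuclideanSpace.single j (1:ℝ)) (fun y => F y j) x) x‖ ≤
      3 * (R₁ / (4 * π) * (12 * (3 * (volume : Measure (EuclideanSpace ℝ (Fin 3))).real (ball 0 1)) / (1 + ‖x‖))) := by
  have h0' : ∀ j : Fin 3, ∀ y, (1 + ‖y‖) ^ 2 * ‖F y j‖ ≤ R₀ := fun j y => by
    rw [Real.norm_eq_abs]; exact sq_weight_abs_coord_le h0 j y
  have hd : ∀ j ∈ (Finset.univ : Finset (Fin 3)), DifferentiableAt ℝ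
      (newtonGradPotential (EuclideanSpace.single j (1:ℝ)) (fun y => F y j)) x := fun j _ =>
    (hasFDerivAt_newtonGradPotential_of_sq_weight (contDiff_coord hF j) (h0' j)
      (sq_weight_norm_fderiv_coord_le hF h1 j) _ x).differentiableAt
  rw [fderiv_fun_sum hd]
  have hj : ∀ j : Fin 3, ‖fderiv ℝ (newtonGradPotential (EuclideanSpace.single j (1:ℝ)) (fun y => F y j)) x‖ ≤
      R₁ / (4 * π) * (12 * (3 * (volume : Measure (EuclideanSpace ℝ (Fin 3))).real (ball 0 1)) / (1 + ‖x‖)) := by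
    intro j
    have h := norm_fderiv_newtonGradPotential_le_of_sq_weight (contDiff_coord hF j) (h0' j)
      (sq_weight_norm_fderiv_coord_le hF h1 j) (EuclideanSpace.single j (1:ℝ)) x
    have e : ‖EuclideanSpace.single j (1:ℝ)‖ = 1 := by simp
    rw [e, one_mul] at h
    exact h
  calc ‖∑ j : Fin 3, fderiv ℝ (newtonGradPotential (EuclideanSpace.single j (1:ℝ)) (fun y => F y j)) x‖
      ≤ ∑ j : Fin 3, ‖fderiv ℝ (newtonGradPotential (EuclideanSpace.single j (1:ℝ)) (fun y => F y j)) x‖ :=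
        norm_sum_le _ _
    _ ≤ ∑ _j : Fin 3, R₁ / (4 * π) * (12 * (3 * (volume : Measure (EuclideanSpace ℝ (Fin 3))).real (ball 0 1)) /
          (1 + ‖x‖)) := Finset.sum_le_sum fun j _ => hj j
    _ = _ := by rw [Finset.sum_const, Finset.card_univ, Fintype.card_fin]; simp

/-! ## `ΔQ = div F` in `𝒟′(ℝ³)` -/

/-- `Σⱼ Fⱼ(y) ∂_{eⱼ}φ(y) = Dφ(y)[F(y)]`. -/
theorem sum_coord_mul_fderiv_single (φ : EuclideanSpace ℝ (Fin 3) → ℝ) (y : EuclideanSpace ℝ (Fin 3)) :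
    ∑ j : Fin 3, F y j * fderiv ℝ φ y (EuclideanSpace.single j (1:ℝ)) = fderiv ℝ φ y (F y) := by
  conv_rhs => rw [← (EuclideanSpace.basisFun (Fin 3) ℝ).sum_repr (F y)]
  simp [map_sum, map_smul, smul_eq_mul]

/-- **The free pressure solves `ΔQ = div F` in the sense of distributions**: for `F ∈ C¹` with
`(1+|y|)²‖F‖ ≤ R₀` and every `φ ∈ C³_c(ℝ³)`, `∫ Q Δφ = ∫ φ div F` (`Q = Σⱼ T_{eⱼ}Fⱼ`). -/
theorem integral_freePressure_mul_laplacian (hF : ContDiff ℝ 1 F) (h0 : ∀ y, (1 + ‖y‖) ^ 2 * ‖F y‖ ≤ R₀)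
    {φ : EuclideanSpace ℝ (Fin 3) → ℝ} (hφ : ContDiff ℝ 3 φ) (hφc : HasCompactSupport φ) :
    ∫ x, (∑ j : Fin 3, newtonGradPotential (EuclideanSpace.single j (1:ℝ)) (fun y => F y j) x) * Δ φ x =
      ∫ y, φ y * VectorCalculus.divergence F y := by
  have hΔc : Continuous (Δ φ) := (contDiff_one_laplacian hφ).continuous
  have hΔs : HasCompactSupport (Δ φ) := hasCompactSupport_laplacian hφc
  have hFc : Continuous F := hF.continuous
  have hcoordc : ∀ j : Fin 3, Continuous fun y => F y j := fun j => (contDiff_coord hF j).continuous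
  have h0j : ∀ j : Fin 3, ∀ y, (1 + ‖y‖) ^ 2 * |F y j| ≤ R₀ := fun j => sq_weight_abs_coord_le h0 j
  have h0j' : ∀ j : Fin 3, ∀ y, (1 + ‖y‖) ^ 2 * ‖F y j‖ ≤ R₀ := fun j y => by
    rw [Real.norm_eq_abs]; exact h0j j y
  -- `Tⱼ Fⱼ` is continuous, so `Tⱼ Fⱼ · Δφ` is integrable
  have hTc : ∀ j : Fin 3, Continuous (newtonGradPotential (EuclideanSpace.single j (1:ℝ)) (fun y => F y j)) :=
    fun j => continuous_newtonGradPotential_of_sq_weight (hcoordc j) (h0j' j) _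
  have hI : ∀ j ∈ (Finset.univ : Finset (Fin 3)), Integrable
      (fun x => newtonGradPotential (EuclideanSpace.single j (1:ℝ)) (fun y => F y j) x * Δ φ x)
      (volume : Measure (EuclideanSpace ℝ (Fin 3))) := fun j _ =>
    ((hTc j).mul hΔc).integrable_of_hasCompactSupport hΔs.mul_left
  have hI' : ∀ j ∈ (Finset.univ : Finset (Fin 3)), Integrable
      (fun y => F y j * fderiv ℝ φ y (EuclideanSpace.single j (1:ℝ))) (volume : Measure (EuclideanSpace ℝ (Fin 3))) :=
    fun j _ => ((hcoordc j).mul ((hφ.continuous_fderiv (by norm_num)).clm_apply continuous_const))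
      |>.integrable_of_hasCompactSupport (hφc.fderiv_apply (𝕜 := ℝ) _).mul_left
  calc ∫ x, (∑ j : Fin 3, newtonGradPotential (EuclideanSpace.single j (1:ℝ)) (fun y => F y j) x) * Δ φ x
      = ∫ x, ∑ j : Fin 3, newtonGradPotential (EuclideanSpace.single j (1:ℝ)) (fun y => F y j) x * Δ φ x := by
        refine integral_congr_ae (Eventually.of_forall fun x => ?_); simp only [Finset.sum_mul]
    _ = ∑ j : Fin 3, ∫ x, newtonGradPotential (EuclideanSpace.single j (1:ℝ)) (fun y => F y j) x * Δ φ x :=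
        integral_finsetSum _ hI
    _ = ∑ j : Fin 3, -∫ y, F y j * fderiv ℝ φ y (EuclideanSpace.single j (1:ℝ)) :=
        Finset.sum_congr rfl fun j _ => integral_newtonGradPotential_mul_laplacian (hcoordc j) (h0j j) hφ hφc _
    _ = -∫ y, ∑ j : Fin 3, F y j * fderiv ℝ φ y (EuclideanSpace.single j (1:ℝ)) := by
        rw [Finset.sum_neg_distrib, integral_finsetSum _ hI']
    _ = -∫ y, fderiv ℝ φ y (F y) := by
        congr 1
        exact integral_congr_ae (Eventually.of_forall fun y => sum_coord_mul_fderiv_single φ y)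
    _ = ∫ y, φ y * VectorCalculus.divergence F y := by
        rw [integral_fderiv_apply_eq_neg_integral_mul_divergence_of_hasCompactSupport hF
          (hφ.of_le (by norm_num)) hφc, neg_neg]

end FreePressure

end Summit.NavierStokesRegularity.NavierStokesRegularity.Theorems.KelvinGate

end
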